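import Summits.Schanuel.Schanuel.Theorems.DiophantineDichotomyApproximationPropertyCycleAPIAt3Data
import HarnessLib

/-!
# The clause-free `t = 3` descent with its data and a THIN third cut (stub `stub_cycleAP3DataThin_of`)

Crux `stmt-Schanuel-6117` (`Summit.Schanuel.Schanuel.Theses.DiophantineDichotomy.ApproximationProperty`),
line `orbit-interpolation-determinant`, skeleton v17, registered stub `stub_cycleAP3DataThin_of`:
from the AVOIDING box principle (the registered neighbour `stub_boxAvoiding`, taken verbatim as
the hypothesis `hA`) the clause-free descent in `ℙ³` with its construction data (`CycleAP3Datum`;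
template `CycleAP3DataProof.main`, `…CycleAPIAt3Data.lean`) is re-run with ONE change: the third
form `T` of degree `τ = a + b + ⌊Δ⌋` is taken by the avoiding box over all monomials of degree
`τ`, avoiding the degree-`τ` piece of the selected prime curve `𝔮₂` and of EVERY minimal prime
`𝔮''` of the complete intersection `(Q, P)` whose degree-`τ` piece has codimension
`≥ M₃ = ⌊Δ⌋ deg 𝔮₂` in `ℚ[x]_τ` (`CycleAP3DataThinProof.main`). Hence `T ∉ 𝔮₂` (codimension of
`(𝔮₂)_τ` is `≥ (τ − a − b) deg 𝔮₂ = M₃`, `curveHilbert_lowerBound`), `a + b + ⌊Δ⌋ ≤ τ`, and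
every minimal prime `𝔮''` of `(Q, P)` containing `T` is THIN:
`dim ℚ[x]_τ < dim(ℚ[x]_τ ∩ 𝔮'') + M₃ ≤ dim(ℚ[x]_τ ∩ 𝔮'') + 2⌊Δ⌋ deg 𝔮₂`.

Bookkeeping: the family has `≤ ab + 1` members (`CycleAP3DataThinProof.card_minimalPrimes_le`:
the `u`-resultant of `P` over the generic plane section of `V(Q)` is `c ∏_𝔮 F_𝔮^{e_𝔮}` over the
minimal primes of `(Q, P)`, `e_𝔮 ≥ 1`, of `u₁`-degree `deg (Q) · b = ab = Σ e_𝔮 deg 𝔮`; LNM 1752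
Ch. 3 Prop. 4.7 1), 4.8 1), 4.11), so with `L = ⌊log₂(ab + 2)⌋ + 1` one has
`ab + 2 ≤ 2^L ≤ (N + 1)^L` and `2L + 8 ≤ ⌊Δ⌋ ≤ M₃` (`loss_facts`, `Δ ≥ 5000`); the template's
adaptive height `h₃ = 4(S₂ + c_B(τ + 1))/M₃` is unchanged and the exponent
`c_B(τ + 1) − ((M₃ − L − 4)/2) log(N₃ + 1) ≤ −S₂` survives since `M₃/4 ≤ (M₃ − L − 4)/2`
(`arith_box3'`). Everything after the box is the template verbatim, same constant
`c = 5000(c₂ + 1)(c_B + 1)`. Proofs only (no definitions, no named facts). Sources: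
Nesterenko–Philippon (eds.), LNM 1752 (2001), Ch. 3 §4 (Prop. 4.7, 4.8, 4.11, 4.13), §5, Ch. 4 §4
p. 61; Philippon, J. Number Theory 81 (2000).
-/

noncomputable section

-- `Summit.Schanuel.Schanuel.…` is the mandated summit/sub-problem namespace (single-conjunct summit), hence:
set_option linter.dupNamespace false

namespace Summit.Schanuel.Schanuel.Cruxes.ApproximationProperty.OrbitInterpolationDeterminant

open Literature.NumberTheory.Transcendental Literature.NumberTheory.Transcendental.Nesterenko
open Literature.NumberTheory.Transcendental.PhilipponMain (cons_one_ne_zero one_le_norm_cons_one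
  ringKrullDim_quotient_eq_of_isUnmixedOfRank isUnmixedOfRank_span_singleton)
open MvPolynomial Real Module
open Literature.RingTheory.MvPolynomial (idealDegree)
open scoped BigOperators

namespace CycleAP3DataThinProof

/-- `3(2n + 9)² < 2ⁿ` for `n ≥ 28`. [folklore] -/
theorem three_mul_sq_lt_two_pow {n : ℕ} (hn : 28 ≤ n) : 3 * (2 * n + 9) ^ 2 < 2 ^ n := by
  induction n, hn using Nat.le_induction with
  | base => norm_num
  | succ n hn ih =>
    have h1 : 3 * (2 * (n + 1) + 9) ^ 2 ≤ 2 * (3 * (2 * n + 9) ^ 2) := by nlinarith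
    rw [pow_succ 2 n]
    omega

/-- If `2ⁿ ≤ 3g²` and `g ≥ 64` then `2n + 10 ≤ g`. [folklore] -/
theorem two_mul_add_ten_le {n g : ℕ} (hg : 64 ≤ g) (h : 2 ^ n ≤ 3 * g ^ 2) : 2 * n + 10 ≤ g := by
  by_cases hn : n ≤ 27
  · omega
  · by_contra hlt
    have hg' : g ≤ 2 * n + 9 := by omega
    have h1 : 3 * g ^ 2 ≤ 3 * (2 * n + 9) ^ 2 := Nat.mul_le_mul_left 3 (Nat.pow_le_pow_left hg' 2)
    have h2 := three_mul_sq_lt_two_pow (by omega : 28 ≤ n)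
    omega

/-- **The loss exponent.** For `g ≥ 64`, `a ≤ g`, `b ≤ 2g + 1` there is `L` (namely
`⌊log₂(ab + 2)⌋ + 1`) with `ab + 2 ≤ 2^L` and `2L + 8 ≤ g`. [folklore] -/
theorem loss_facts {a b g : ℕ} (hg : 64 ≤ g) (ha : a ≤ g) (hb : b ≤ 2 * g + 1) :
    ∃ L : ℕ, a * b + 2 ≤ 2 ^ L ∧ 2 * L + 8 ≤ g := by
  refine ⟨Nat.log 2 (a * b + 2) + 1, (Nat.lt_pow_succ_log_self (by norm_num) _).le, ?_⟩
  have h1 : 2 ^ Nat.log 2 (a * b + 2) ≤ a * b + 2 := Nat.pow_log_le_self 2 (by omega)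
  have hab : a * b ≤ g * (2 * g + 1) := Nat.mul_le_mul ha hb
  have hgg : g + 2 ≤ g * g := by nlinarith
  have h2 : a * b + 2 ≤ 3 * g ^ 2 := by nlinarith
  have := two_mul_add_ten_le hg (h1.trans h2)
  omega

/-- The exponent of the avoiding third form: `c_B(b₃ + 1) − ((M − L − 4)/2) Λ ≤ −S` once
`M = g deg 𝔮 ≥ 2L + 8`, `h₃ (g deg 𝔮) = 4(S + c_B(b₃ + 1))` and `h₃ ≤ Λ` (the template's
`CycleAP3PrimeOfCurve.arith_box3` with the loss `L` of the avoidance: `M/4 ≤ (M − L − 4)/2`).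
[folklore] -/
theorem arith_box3' {S cB b₃ M g δ L Λ h₃ : ℝ} (hS : 0 ≤ S) (hcB : 0 < cB) (hb0 : 0 ≤ b₃)
    (hg : 0 < g) (hδ : 0 < δ) (hM : M = g * δ) (hML : 2 * L + 8 ≤ M)
    (hh₃ : h₃ * (g * δ) = 4 * (S + cB * (b₃ + 1))) (hΛ : h₃ ≤ Λ) :
    cB * (b₃ + 1) - (M - L - 4) / 2 * Λ ≤ -S := by
  have hM0 : 0 < M := by rw [hM]; positivity
  have hh₃0 : 0 ≤ h₃ := by
    refine le_of_mul_le_mul_right ?_ (mul_pos hg hδ)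
    rw [zero_mul, hh₃]; positivity
  have h1 : M / 4 * h₃ = S + cB * (b₃ + 1) := by
    rw [hM]
    linear_combination hh₃ / 4
  have h2 : M / 4 * h₃ ≤ (M - L - 4) / 2 * Λ := mul_le_mul (by linarith) hΛ hh₃0 (by linarith)
  linarith

/-- **At most `ab` components.** The complete intersection `(Q, P)` of `ℚ[x₀, …, x₃]` (`(Q)` prime,
`Q ≠ 0` a form of degree `a ≥ 1`, `P ∉ (Q)` a form of degree `b ≥ 1`) has at most `ab` minimal
primes: the `u`-resultant of `P` over the generic plane section of `V(Q)` is `c ∏_𝔮 F_𝔮^{e_𝔮}` over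
them (`e_𝔮 ≥ 1`), the unmixed ideal `J` of the cycle has `deg J = Σ e_𝔮 deg 𝔮` (Prop. 4.7 1)) and
`deg J = deg_{u₁}(u-resultant) = deg (Q) · b = ab` (Prop. 4.8 1), 4.11), and every `deg 𝔮 ≥ 1`.
[cite: NesterenkoPhilippon2001, Ch. 3 Prop. 4.7 1), Prop. 4.8 1), Prop. 4.11 (pp. 39–41)] -/
theorem card_minimalPrimes_le {Q P : Rx 3} {a b : ℕ} (hQ0 : Q ≠ 0) (hQhom : Q.IsHomogeneous a)
    (ha : 1 ≤ a) (hQprime : (Ideal.span {Q}).IsPrime) (hPhom : P.IsHomogeneous b) (hb : 1 ≤ b)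
    (hPQ : P ∉ Ideal.span {Q}) {𝓠 : Finset (Ideal (Rx 3))}
    (h𝓠 : (𝓠 : Set (Ideal (Rx 3))) = (Ideal.span {Q} ⊔ Ideal.span {P}).minimalPrimes) :
    𝓠.card ≤ a * b := by
  classical
  have h44 := NesterenkoPhilippon2001_ch3_prop_4_4_holds
  -- `(Q)` is homogeneous (Mathlib's grading `MvPolynomial.gradedAlgebra`, passed explicitly)
  have h𝔭hom := @SpaceCI.isHomogeneous_span 3 MvPolynomial.gradedAlgebra Q a hQhom
  have h𝔭unm : IsUnmixedOfRank (Ideal.span {Q}) 3 :=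
    isUnmixedOfRank_span_singleton hQ0 fun h => hQprime.ne_top (Ideal.span_singleton_eq_top.mpr h)
  have hP0 : P ≠ 0 := SpaceCI.ne_zero_of_notMem hPQ
  -- a primitive integer model `P = p · P₀`
  obtain ⟨p, hp, P₀, hPP₀, hsupp, -⟩ := exists_eq_C_mul_map_primitive P hP0
  have hP₀ : P₀.IsHomogeneous b := by
    intro e he
    have he' : e ∈ P.support := by rw [← hsupp]; exact mem_support_iff.mpr he
    exact hPhom (mem_support_iff.mp he')
  -- the `u`-resultant factors over the minimal primes with positive exponents
  obtain ⟨c, hc, e, he, hG⟩ := exists_uResultant_eq_C_mul_prod_pow (s := 2) (by norm_num)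
    (by norm_num) hQprime h𝔭hom h𝔭unm hPhom hb hPQ hp hPP₀ hP₀ h𝓠
  -- the unmixed ideal of the cycle with these exponents: `deg J = Σ e_𝔮 deg 𝔮`
  obtain ⟨J, -, -, -, -, -, ⟨c₁, hc₁, hJF⟩, hdeg⟩ :=
    exists_cycle_ideal h44 (r := 2 + 1) (by norm_num) (by norm_num) hQprime h𝔭hom h𝔭unm hPhom hb
      hPQ h𝓠 e he
  rw [Nat.add_sub_cancel] at hJF hdeg
  -- and `deg J = deg_{u₁}(u-resultant) = deg (Q) · b = ab`
  have hprod : ∏ 𝔮 ∈ 𝓠, chowForm 𝔮 2 ^ e 𝔮 = C c⁻¹ * uResultant (Ideal.span {Q}) 2 b P₀ := by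
    rw [hG, ← mul_assoc, ← map_mul, inv_mul_cancel₀ hc, map_one, one_mul]
  rw [hprod, ← mul_assoc, ← map_mul] at hJF
  obtain ⟨hdegJ, -, -⟩ := invariants_of_chowForm_eq_C_mul (s := 2) (by norm_num)
    (mul_ne_zero hc₁ (inv_ne_zero hc)) hJF
  have hbd : blockDeg (uResultant (Ideal.span {Q}) 2 b P₀) ⟨0, by norm_num⟩ =
      ideg (Ideal.span {Q}) 3 * b :=
    blockDeg_uResultant (s := 2) (by norm_num) (by norm_num) hQprime h𝔭hom h𝔭unm hPhom hb hPQ hp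
      hPP₀ hP₀
  have hQdeg : ideg (Ideal.span {Q}) 3 = a := ideg_span_singleton (by norm_num) hQ0 hQhom ha
  have hsum : ∑ 𝔮 ∈ 𝓠, e 𝔮 * ideg 𝔮 2 = a * b := by rw [← hdeg, hdegJ, hbd, hQdeg]
  -- every summand is `≥ 1`
  have hterm : ∀ 𝔮 ∈ 𝓠, 1 ≤ e 𝔮 * ideg 𝔮 2 := fun 𝔮 h𝔮 => by
    have hmin : 𝔮 ∈ (Ideal.span {Q} ⊔ Ideal.span {P}).minimalPrimes := by
      rw [← h𝓠]; exact Finset.mem_coe.mpr h𝔮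
    obtain ⟨hprime, hhom, -, hunm, -⟩ :=
      minimalPrimes_cut_facts (r := 2 + 1) (by norm_num) hQprime h𝔭hom h𝔭unm hPhom hPQ hmin
    rw [Nat.add_sub_cancel] at hunm
    exact Nat.mul_le_mul (he 𝔮 h𝔮)
      (Literature.Barriers.Schanuel.one_le_ideg_of_isPrime h44 (by norm_num) (by norm_num) hprime hhom
        hunm)
  calc 𝓠.card = ∑ 𝔮 ∈ 𝓠, 1 := by simp
    _ ≤ ∑ 𝔮 ∈ 𝓠, e 𝔮 * ideg 𝔮 2 := Finset.sum_le_sum hterm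
    _ = a * b := hsum

/-- **The clause-free `t = 3` descent with its data and a thin third cut** (curried content of the
registered stub `stub_cycleAP3DataThin_of`): granting the avoiding box principle `hA`, for every
`ω ∈ ℂ³` there is `c = 5000(c₂ + 1)(c_B + 1)` such that for `c ≤ Δ ≤ Y` the template's `Q`, `P`,
`𝔮`, a third form `T` of degree `τ = a + b + ⌊Δ⌋` outside `𝔮` and outside every minimal prime
`𝔮''` of `(Q, P)` with `dim(ℚ[x]_τ ∩ 𝔮'') + ⌊Δ⌋ deg 𝔮 ≤ dim ℚ[x]_τ`, and the selected orbit
`𝔭 ⊇ 𝔮 + (T)` form a `CycleAP3Datum`; so the minimal primes of `(Q, P)` containing `T` are thin.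
[cite: NesterenkoPhilippon2001, Ch. 3 Prop. 4.7, Prop. 4.11, Prop. 4.13 (pp. 39–41); Ch. 4 §4 p. 61] -/
theorem main
    (hA : ∀ (m : ℕ) (ω : Fin m → ℂ), ∃ c : ℝ, 0 < c ∧
      ∀ (b N M L : ℕ) (F : Finset (Submodule ℚ (Rx m))), 1 ≤ N → L + 4 ≤ M →
        F.card + 1 ≤ (N + 1) ^ L → M ≤ Module.finrank ℚ ↥(homogeneousSubmodule (Fin (m + 1)) ℚ b) →
        (∀ W ∈ F, Module.finrank ℚ ↥(homogeneousSubmodule (Fin (m + 1)) ℚ b ⊓ W) + M ≤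
          Module.finrank ℚ ↥(homogeneousSubmodule (Fin (m + 1)) ℚ b)) →
        ∃ R : Rx m, (∀ W ∈ F, R ∉ W) ∧ R.IsHomogeneous b ∧ 1 ≤ maxNorm R ∧ maxNorm R ≤ N ∧
          height R ≤ Real.log N ∧
          ‖aeval (Fin.cons 1 ω : Fin (m + 1) → ℂ) R‖ ≤
            Real.exp (c * (b + 1) - ((M : ℝ) - L - 4) / 2 * Real.log ((N : ℝ) + 1)))
    (ω : Fin 3 → ℂ) :
    ∃ c : ℝ, 1 ≤ c ∧ ∀ Δ Y : ℝ, c ≤ Δ → Δ ≤ Y →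
      ∃ (Q : Rx 3) (a : ℕ) (P : Rx 3) (b : ℕ) (𝔮₂ : Ideal (Rx 3)) (T : Rx 3) (τ : ℕ)
        (𝔭 : Ideal (Rx 3)), CycleAP3Datum ω c Δ Y Q a P b 𝔮₂ T τ 𝔭 ∧ a + b + ⌊Δ⌋₊ ≤ τ ∧
        ∀ 𝔮'' ∈ (Ideal.span {Q} ⊔ Ideal.span {P}).minimalPrimes, T ∈ 𝔮'' →
          Module.finrank ℚ ↥(homogeneousSubmodule (Fin (3 + 1)) ℚ τ) <
            Module.finrank ℚ ↥(homogeneousSubmodule (Fin (3 + 1)) ℚ τ ⊓ 𝔮''.restrictScalars ℚ) +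
              2 * ⌊Δ⌋₊ * ideg 𝔮₂ 2 := by
  classical
  unfold CycleAP3Datum
  obtain ⟨c₂, hc₂, hS⟩ := smallPrimeCurve3_of small_prime_hypersurface ω
  obtain ⟨cB, hcB, hBox⟩ := hA 3 ω
  set ω₁ : Fin (3 + 1) → ℂ := Fin.cons 1 ω with hω₁def
  have hω₁ : ω₁ ≠ 0 := cons_one_ne_zero ω
  have hΘ : 1 ≤ ‖ω₁‖ := one_le_norm_cons_one ω
  set c : ℝ := 5000 * (c₂ + 1) * (cB + 1) with hcdef
  have hprod : 0 ≤ c₂ * cB := by positivity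
  have hc5000 : 5000 ≤ c := by rw [hcdef]; nlinarith [hprod]
  have hcc₂ : 5000 * c₂ ≤ c := by rw [hcdef]; nlinarith [hprod]
  have hccB : 5000 * cB ≤ c := by rw [hcdef]; nlinarith [hprod]
  obtain ⟨hc₂c, hc₂0, hc1, hc0⟩ : c₂ ≤ c ∧ 0 < c₂ ∧ 1 ≤ c ∧ 0 < c :=
    ⟨by linarith, by linarith, by linarith, by linarith⟩
  refine ⟨c, hc1, fun Δ Y hΔ hY => ?_⟩
  obtain ⟨hΔ1, hΔ0, hY0, hYpos⟩ : 1 ≤ Δ ∧ 0 < Δ ∧ 0 ≤ Y ∧ 0 < Y :=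
    ⟨by linarith, by linarith, by linarith, by linarith⟩
  obtain ⟨Q, a, P, b, 𝔮, hQ0, hQhom, ha1, haΔ, hQprime, hPhom, hb1, hbΔ, hPQ, hqprime, hqhom,
    hqunm, hQq, hPq, hdeg, hh, habs⟩ := hS Δ Y (by linarith) hY
  have hδ1n : 1 ≤ ideg 𝔮 2 :=
    Literature.Barriers.Schanuel.one_le_ideg_of_isPrime NesterenkoPhilippon2001_ch3_prop_4_4_holds
      (by norm_num) (by norm_num) hqprime hqhom hqunm
  set δ : ℝ := (ideg 𝔮 2 : ℝ) with hδdef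
  have hδ1 : 1 ≤ δ := by rw [hδdef]; exact_mod_cast hδ1n
  have hδ0 : 0 < δ := by linarith
  set h : ℝ := iheight 𝔮 2 with hhdef
  have hh0 : 0 ≤ h := height_nonneg _
  have hX0 : 0 ≤ Δ * h + Y * δ := by positivity
  set S₂ : ℝ := Δ / c₂ * (Δ * h + Y * δ) with hS₂def
  have hS₂0 : 0 ≤ S₂ := by rw [hS₂def]; positivity
  have hS₂X : S₂ ≤ Δ * (Δ * h + Y * δ) := by
    rw [hS₂def]
    exact mul_le_mul_of_nonneg_right (div_le_self hΔ0.le hc₂) hX0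
  have hhc : h ≤ c * Δ * Y :=
    hh.trans (mul_le_mul_of_nonneg_right (mul_le_mul_of_nonneg_right hc₂c hΔ0.le) hY0)
  have hS₂c : Δ / c * (Δ * h + Y * δ) ≤ S₂ := by
    rw [hS₂def]
    exact mul_le_mul_of_nonneg_right (div_le_div_of_nonneg_left hΔ0.le hc₂0 hc₂c) hX0
  have habsc : iabs 𝔮 2 ω₁ ≤ exp (-(Δ / c * (Δ * h + Y * δ))) :=
    habs.trans (exp_le_exp.mpr (neg_le_neg hS₂c))
  obtain ⟨g, hgdef⟩ : ∃ g : ℕ, g = ⌊Δ⌋₊ := ⟨_, rfl⟩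
  obtain ⟨hag, hg10, hgΔ, hΔg⟩ := CycleAPITwo.floor_facts haΔ (by linarith : (10 : ℝ) ≤ Δ)
  rw [← hgdef] at hag hg10 hgΔ hΔg
  have hg0 : (0 : ℝ) < g := by exact_mod_cast (show 0 < g by omega)
  have hg64 : 64 ≤ g := by exact_mod_cast (show (64 : ℝ) ≤ g by linarith)
  have hbg : b ≤ 2 * g + 1 := by
    have h' : (g : ℝ) = ⌊Δ⌋₊ := by exact_mod_cast hgdef
    have h1 : (b : ℝ) < 2 * (g : ℝ) + 2 := by linarith [Nat.lt_floor_add_one Δ]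
    have h2 : b < 2 * g + 2 := by exact_mod_cast h1
    omega
  obtain ⟨b₃, hb₃def⟩ : ∃ b₃ : ℕ, b₃ = a + b + g := ⟨_, rfl⟩
  obtain ⟨hab, hb₃g, hb₃1⟩ : a + b ≤ b₃ ∧ b₃ - a - b = g ∧ 1 ≤ b₃ := by omega
  have hb₃R : (b₃ : ℝ) ≤ 4 * Δ := by rw [hb₃def]; push_cast; linarith
  have hb₃5 : (b₃ : ℝ) ≤ 5 * Δ := by linarith
  have hb₃0 : (0 : ℝ) ≤ b₃ := Nat.cast_nonneg _
  have hdim : ringKrullDim (Rx 3 ⧸ 𝔮) = (2 : ℕ) :=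
    ringKrullDim_quotient_eq_of_isUnmixedOfRank hqprime hqunm
  have hHilb := curveHilbert_lowerBound Q P a b hQ0 hQhom hPhom ha1 hb1 hQprime hPQ 𝔮 hqprime hqhom
    hQq hPq hdim b₃ hab
  obtain ⟨M₃, hM₃def⟩ : ∃ M : ℕ, M = g * ideg 𝔮 2 := ⟨_, rfl⟩
  rw [hb₃g, ← hM₃def] at hHilb
  have hM₃R : (M₃ : ℝ) = (g : ℝ) * δ := by rw [hM₃def, Nat.cast_mul, hδdef]
  have hfin : finrank ℚ ↥(homogeneousSubmodule (Fin (3 + 1)) ℚ b₃ ⊓ 𝔮.restrictScalars ℚ) + M₃ ≤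
      finrank ℚ ↥(homogeneousSubmodule (Fin (3 + 1)) ℚ b₃) := by
    have e : finrank ℚ ↥(homogeneousSubmodule (Fin (3 + 1)) ℚ b₃ ⊓ 𝔮.restrictScalars ℚ) =
        finrank ℚ ↥(idealDegree 𝔮 b₃) := by
      rw [idealDegree, inf_comm]
    rw [e]
    omega
  have hM₃fin : M₃ ≤ finrank ℚ ↥(homogeneousSubmodule (Fin (3 + 1)) ℚ b₃) :=
    le_trans (Nat.le_add_left _ _) hfin
  -- the loss exponent `L`: `ab + 2 ≤ 2^L`, `2L + 8 ≤ g ≤ M₃`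
  obtain ⟨L, hL1, hL2⟩ := loss_facts hg64 hag hbg
  have hLM : 2 * L + 8 ≤ M₃ := by
    rw [hM₃def]; exact hL2.trans (le_mul_of_one_le_right (Nat.zero_le _) hδ1n)
  have hLMR : 2 * (L : ℝ) + 8 ≤ (M₃ : ℝ) := by exact_mod_cast hLM
  set h₃ : ℝ := 4 * (S₂ + cB * (b₃ + 1)) / (g * δ) with hh₃def
  have hh₃0 : 0 ≤ h₃ := by rw [hh₃def]; positivity
  have hh₃eq : h₃ * (g * δ) = 4 * (S₂ + cB * (b₃ + 1)) := by
    rw [hh₃def]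
    exact div_mul_cancel₀ _ (by positivity)
  obtain ⟨N₃, hN₃def⟩ : ∃ N : ℕ, N = ⌊exp h₃⌋₊ := ⟨_, rfl⟩
  obtain ⟨hN1, hlogN, hlogN1⟩ := CycleAPITwo.box_facts hh₃0
  rw [← hN₃def] at hN1 hlogN hlogN1
  -- the family to avoid: `𝔮` and the non-thin minimal primes of `(Q, P)`, at most `ab + 1` members
  obtain ⟨𝓠, h𝓠, -⟩ := exists_finset_minimalPrimes_cut (𝔭 := Ideal.span {Q})
    (@SpaceCI.isHomogeneous_span 3 MvPolynomial.gradedAlgebra Q a hQhom) hQprime.ne_top hPhom hb1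
  have h𝓠card : 𝓠.card ≤ a * b := card_minimalPrimes_le hQ0 hQhom ha1 hQprime hPhom hb1 hPQ h𝓠
  set F : Finset (Submodule ℚ (Rx 3)) := insert (𝔮.restrictScalars ℚ)
    ((𝓠.filter fun 𝔮'' => finrank ℚ ↥(homogeneousSubmodule (Fin (3 + 1)) ℚ b₃ ⊓
        𝔮''.restrictScalars ℚ) + M₃ ≤ finrank ℚ ↥(homogeneousSubmodule (Fin (3 + 1)) ℚ b₃)).image
      fun 𝔮'' => 𝔮''.restrictScalars ℚ) with hFdef
  have hFcodim : ∀ W ∈ F, finrank ℚ ↥(homogeneousSubmodule (Fin (3 + 1)) ℚ b₃ ⊓ W) + M₃ ≤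
      finrank ℚ ↥(homogeneousSubmodule (Fin (3 + 1)) ℚ b₃) := by
    intro W hW
    rw [hFdef, Finset.mem_insert, Finset.mem_image] at hW
    rcases hW with rfl | ⟨𝔮'', h𝔮'', rfl⟩
    · exact hfin
    · exact (Finset.mem_filter.mp h𝔮'').2
  have hcardF : F.card + 1 ≤ (N₃ + 1) ^ L := by
    have h1 : F.card ≤ 𝓠.card + 1 := by
      rw [hFdef]
      refine (Finset.card_insert_le _ _).trans (Nat.add_le_add_right ?_ 1)
      exact Finset.card_image_le.trans (Finset.card_filter_le _ _)
    calc F.card + 1 ≤ a * b + 2 := by omega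
      _ ≤ 2 ^ L := hL1
      _ ≤ (N₃ + 1) ^ L := Nat.pow_le_pow_left (by omega) L
  -- the third form `P₃`, outside every member of `F`
  obtain ⟨P₃, hP₃F, hP₃hom, hP₃1, -, hhP₃, hP₃val⟩ :=
    hBox b₃ N₃ M₃ L F hN1 (by omega) hcardF hM₃fin hFcodim
  have hP₃q : P₃ ∉ 𝔮 := fun hmem =>
    hP₃F _ (by rw [hFdef]; exact Finset.mem_insert_self _ _)
      ((Submodule.restrictScalars_mem ℚ 𝔮 P₃).mpr hmem)
  set hP : ℝ := height P₃ with hPdef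
  have hP0 : 0 ≤ hP := height_nonneg _
  have hPh₃ : hP ≤ h₃ := hhP₃.trans hlogN
  have hK : hP * δ ≤ 8 * (Δ * h + Y * δ) + 40 * cB := by
    have h1 : hP * δ ≤ h₃ * δ := mul_le_mul_of_nonneg_right hPh₃ hδ0.le
    have h2 := CycleAP3PrimeOfCurve.h3delta_le (cB := cB) (b₃ := (b₃ : ℝ)) hX0 hS₂X hcB hΔ1 hΔg
      hδ0 hb₃R
    rw [← hh₃def] at h2
    linarith
  have hnorm : normAt ω₁ P₃ ≤ exp (-S₂) := by
    have h1 : normAt ω₁ P₃ ≤ ‖aeval ω₁ P₃‖ := by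
      rw [normAt]
      exact div_le_self (norm_nonneg _) (one_le_mul_of_one_le_of_one_le hP₃1 (one_le_pow₀ hΘ))
    refine h1.trans (hP₃val.trans (exp_le_exp.mpr ?_))
    exact arith_box3' hS₂0 hcB hb₃0 hg0 hδ0 hM₃R hLMR hh₃eq hlogN1
  set U₃ : ℝ := S₂ - (hP * δ + h * b₃ + 99 * δ * b₃) with hU₃def
  have hcut : hP * δ + h * b₃ + 99 * δ * b₃ + 54 * δ * b₃ ≤ S₂ / 2 :=
    CycleAP3PrimeOfCurve.arith_cut3 hc₂ (by linarith) (by linarith) hΔ hY hδ1 hh0 hb₃R hK hS₂def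
  have hδb : 0 ≤ δ * b₃ := by positivity
  have hU₃S : S₂ / 2 ≤ U₃ := by rw [hU₃def]; linarith
  have hE : height P₃ * (ideg 𝔮 2 : ℝ) + iheight 𝔮 2 * (b₃ : ℝ) +
      11 * ((3 : ℕ) : ℝ) ^ 2 * (ideg 𝔮 2 : ℝ) * (b₃ : ℝ) = hP * δ + h * b₃ + 99 * δ * b₃ := by
    rw [← hPdef, ← hhdef, ← hδdef]
    push_cast
    ring
  have hsmall : max (normAt ω₁ P₃) (iabs 𝔮 2 ω₁) *
      exp (height P₃ * (ideg 𝔮 2 : ℝ) + iheight 𝔮 2 * (b₃ : ℝ) +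
        11 * ((3 : ℕ) : ℝ) ^ 2 * (ideg 𝔮 2 : ℝ) * (b₃ : ℝ)) ≤ exp (-U₃) := by
    refine CycleAPITwo.max_mul_exp_le hnorm habs ?_ ?_ <;> linarith [hE, hU₃def]
  have hU₃54 : 2 * ((3 : ℕ) : ℝ) ^ 3 * ((ideg 𝔮 2 : ℝ) * (b₃ : ℝ)) ≤ U₃ := by
    rw [← hδdef]
    norm_num
    linarith
  obtain ⟨𝔭, h𝔭prime, h𝔭hom, h𝔭unm, hq𝔭, hP₃𝔭, h𝔭deg, h𝔭h, h𝔭abs⟩ :=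
    small_prime_of_cut 3 2 𝔮 P₃ b₃ ω₁ Δ Y U₃ le_rfl (by norm_num) hqprime hqhom hqunm hP₃hom hb₃1
      hP₃q hω₁ hΔ0.le hY0 (by linarith) hsmall hU₃54
  simp only [show (2 : ℕ) - 1 = 1 from rfl] at h𝔭unm h𝔭deg h𝔭h h𝔭abs
  rw [← hPdef, ← hhdef, ← hδdef] at h𝔭h h𝔭abs
  have h𝔭h0 : 0 ≤ iheight 𝔭 1 := height_nonneg _
  refine ⟨Q, a, P, b, 𝔮, P₃, b₃, 𝔭, ⟨hQ0, hQhom, ha1, haΔ, hQprime, hPhom, hb1, hbΔ, hPQ, hqprime,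
    hqhom, hqunm, hQq, hPq, hdeg, ?_, ?_, hP₃hom, hb₃1, hb₃5, hP₃q, h𝔭prime, h𝔭hom, h𝔭unm, hq𝔭,
    hP₃𝔭, h𝔭deg, ?_, ?_, ?_⟩, by omega, fun 𝔮'' h𝔮'' hT𝔮'' => ?_⟩
  · -- the curve's height at constant `c`
    rw [← hhdef]
    exact hhc
  · -- the curve's accuracy at rate `Δ / c`
    rw [← hhdef, ← hδdef]
    exact habsc
  · -- degree budget `deg 𝔭 ≤ deg 𝔮 · b₃ ≤ 8Δ³ ≤ (cΔ)³`
    have h1 : (ideg 𝔭 1 : ℝ) ≤ δ * b₃ := by rw [hδdef]; exact_mod_cast h𝔭deg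
    exact h1.trans (CycleAP3PrimeOfCurve.arith_deg3 (by linarith) hΔ0.le hdeg hb₃0 hb₃R)
  · -- height budget
    have h1 : iheight 𝔭 1 ≤ h * b₃ + hP * δ + 18 * δ * b₃ := by
      refine h𝔭h.trans (le_of_eq ?_)
      push_cast
      ring
    exact h1.trans
      (CycleAP3PrimeOfCurve.arith_height3 (by linarith) hcB hΔ1 hY hδ0.le hdeg hh0 hh hb₃R hK)
  · -- accuracy at the registered rate `1/c`
    have hrate := CycleAP3PrimeOfCurve.arith_rate3 (hP := hP) hc₂ (by linarith) (by linarith) hΔ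
      hY hδ1 hh0 hb₃R hK hS₂def hU₃S
    have hb₃posR : (0 : ℝ) < b₃ := by exact_mod_cast hb₃1
    refine h𝔭abs.trans (CycleAP3PrimeOfCurve.exp_rate_le hc0 ?_ ?_ ?_)
    · have h1 : 0 ≤ Δ * (h * b₃ + hP * δ + (3 * (2 + 1) + 3 ^ 2) * δ * b₃) := by positivity
      have h2 : 0 < Y * (δ * b₃) := mul_pos hYpos (mul_pos hδ0 hb₃posR)
      push_cast
      linarith
    · exact add_nonneg (mul_nonneg hΔ0.le h𝔭h0) (mul_nonneg hY0 (Nat.cast_nonneg _))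
    · refine le_trans (le_of_eq ?_) hrate
      push_cast
      ring
  · -- thinness of the minimal primes of `(Q, P)` containing `P₃`
    by_contra hlt
    have hle : finrank ℚ ↥(homogeneousSubmodule (Fin (3 + 1)) ℚ b₃ ⊓ 𝔮''.restrictScalars ℚ) +
        2 * ⌊Δ⌋₊ * ideg 𝔮 2 ≤ finrank ℚ ↥(homogeneousSubmodule (Fin (3 + 1)) ℚ b₃) :=
      not_lt.mp hlt
    have hM₃2 : M₃ ≤ 2 * ⌊Δ⌋₊ * ideg 𝔮 2 := by
      rw [hM₃def, ← hgdef]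
      exact Nat.mul_le_mul_right _ (by omega)
    have hpred : finrank ℚ ↥(homogeneousSubmodule (Fin (3 + 1)) ℚ b₃ ⊓ 𝔮''.restrictScalars ℚ) +
        M₃ ≤ finrank ℚ ↥(homogeneousSubmodule (Fin (3 + 1)) ℚ b₃) := by omega
    have hmem𝓠 : 𝔮'' ∈ 𝓠 := by rw [← Finset.mem_coe, h𝓠]; exact h𝔮''
    have hmemF : 𝔮''.restrictScalars ℚ ∈ F := by
      rw [hFdef]
      exact Finset.mem_insert_of_mem
        (Finset.mem_image_of_mem _ (Finset.mem_filter.mpr ⟨hmem𝓠, hpred⟩))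
    exact hP₃F _ hmemF ((Submodule.restrictScalars_mem ℚ 𝔮'' P₃).mpr hT𝔮'')

end CycleAP3DataThinProof

/-- **Registered stub `stub_cycleAP3DataThin_of`** (crux `stmt-Schanuel-6117`, line
`orbit-interpolation-determinant`, skeleton v17): the avoiding box principle (`stub_boxAvoiding`)
implies the clause-free `t = 3` descent WITH its construction data and the thinness certificate of
the third cut — `τ ≥ a + b + ⌊Δ⌋`, and every minimal prime `𝔮''` of the c.i. `(Q, P)` containing
`T` has `dim ℚ[x]_τ < dim(ℚ[x]_τ ∩ 𝔮'') + 2⌊Δ⌋ deg 𝔮₂`: `CycleAP3DataThinProof.main`.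
[cite: NesterenkoPhilippon2001, Ch. 3 Prop. 4.7, Prop. 4.8, Prop. 4.11, Prop. 4.13 (pp. 39–41), §5 (p. 42); Ch. 4 §4 p. 61] -/
theorem stub_cycleAP3DataThin_of : (∀ (m : ℕ) (ω : Fin m → ℂ), ∃ c : ℝ, 0 < c ∧ ∀ (b N M L : ℕ) (F : Finset (Submodule ℚ (Rx m))), 1 ≤ N → L + 4 ≤ M → F.card + 1 ≤ (N + 1) ^ L → M ≤ Module.finrank ℚ ↥(homogeneousSubmodule (Fin (m + 1)) ℚ b) → (∀ W ∈ F, Module.finrank ℚ ↥(homogeneousSubmodule (Fin (m + 1)) ℚ b ⊓ W) + M ≤ Module.finrank ℚ ↥(homogeneousSubmodule (Fin (m + 1)) ℚ b)) → ∃ R : Rx m, (∀ W ∈ F, R ∉ W) ∧ R.IsHomogeneous b ∧ 1 ≤ maxNorm R ∧ maxNorm R ≤ N ∧ height R ≤ Real.log N ∧ ‖aeval (Fin.cons 1 ω : Fin (m + 1) → ℂ) R‖ ≤ Real.exp (c * (b + 1) - ((M : ℝ) - L - 4) / 2 * Real.log ((N : ℝ) + 1))) → ∀ ω : Fin 3 →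 ℂ, ∃ c : ℝ, 1 ≤ c ∧ ∀ Δ Y : ℝ, c ≤ Δ → Δ ≤ Y → ∃ (Q : Rx 3) (a : ℕ) (P : Rx 3) (b : ℕ) (𝔮₂ : Ideal (Rx 3)) (T : Rx 3) (τ : ℕ) (𝔭 : Ideal (Rx 3)), CycleAP3Datum ω c Δ Y Q a P b 𝔮₂ T τ 𝔭 ∧ a + b + ⌊Δ⌋₊ ≤ τ ∧ ∀ 𝔮'' ∈ (Ideal.span {Q} ⊔ Ideal.span {P}).minimalPrimes, T ∈ 𝔮'' → Module.finrank ℚ ↥(homogeneousSubmodule (Fin (3 + 1)) ℚ τ) < Module.finrank ℚ ↥(homogeneousSubmodule (Fin (3 + 1)) ℚ τ ⊓ 𝔮''.restrictScalars ℚ) + 2 * ⌊Δ⌋₊ * ideg 𝔮₂ 2 :=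
  fun hA ω => CycleAP3DataThinProof.main hA ω

end Summit.Schanuel.Schanuel.Cruxes.ApproximationProperty.OrbitInterpolationDeterminant

end
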